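import Summits.ResolutionOfSingularities.ResolutionOfSingularities.Theorems.WallCutCritical
import HarnessLib

/-!
# LossIsFatal — the CLOSING LAW of the located residual `WallCut.NoLossyStrictTailsDeep`, TYPED ONCE:
the local statement, its two DEFECT BRANCHES, and the local-to-tail step (all proved here are pure logic)

decomp-res-lens-3, gen 26 (row 214 window for g27: «(R′) OUTRIGHT = LossIsFatal ⇒ `NoLossyStrictTailsDeep`, hyp-free,
port-free, all `pᵉ`, by branch type + the local-to-tail step typed ONCE»).  This file types the TARGET of the branch
programme and proves the bookkeeping around it; it imports only the landed `WallCutCritical` (sub-critical reduction).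

* `LossIsFatalDeep` — on a small-dead strict SUB-CRITICAL plateau (`3 ≤ s < pᵉ`, binders of the residual verbatim with the
  ONE extra binder `s < p ^ e` of `WallCutCritical.noLossyStrictTailsDeep_of_subcritical`) NO stage `t ≥ N` is a TOTAL LOSS
  (the residual's last binder «total losses beyond every bound» is replaced by ONE total loss at a stage `t ≥ N`).
* `LossIsFatalBottomDeep` / `LossIsFatalDefectDeep` — the same with the LOSS DEFECT pinned: order right after the loss
  `= pᵉ + 1` (bottom, `δ = 0`; its deepest leaf family — a full straight untranslated run — is the g26 kernel law
  `WallCutBottom.bottom_run_false`) resp. `≠ pᵉ + 1` (`δ ≥ 1`; by plateau arithmetic only cells with `2s ≥ pᵉ + 3`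
can carry it).
* `lossIsFatalDeep_of_branches`, `noLossyStrictTailsDeep_of_lossIsFatalDeep`, `noLossyStrictTailsDeep_of_branches` — PROVED.
-/

open MvPolynomial Finset
open Literature.AlgebraicGeometry.Resolution
open Literature.AlgebraicGeometry.Resolution.Hauser2010
open Literature.AlgebraicGeometry.Resolution.PointBlowup
open Summit.ResolutionOfSingularities.ResolutionOfSingularities.Theorems.TightDefectClasses
open Summit.ResolutionOfSingularities.ResolutionOfSingularities.Theorems.TightDefectStrongWalks
open Summit.ResolutionOfSingularities.ResolutionOfSingularities.Theorems.ItineraryCutClasses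
open Summit.ResolutionOfSingularities.ResolutionOfSingularities.Theorems.BoundaryLedger
open Summit.ResolutionOfSingularities.ResolutionOfSingularities.Theorems.ProximityCut
open Summit.ResolutionOfSingularities.ResolutionOfSingularities.Theorems.WallCut
open Summit.ResolutionOfSingularities.ResolutionOfSingularities.Theorems.WallCutCritical

namespace Summit.ResolutionOfSingularities.ResolutionOfSingularities.Theorems.LossIsFatal

/-- **LOSS IS FATAL (sub-critical, deep) — THE TARGET OF THE BRANCH PROGRAMME.**  Binders of `WallCut.NoLossyStrictTailsDeep`
VERBATIM with `s < p ^ e` inserted after `p ^ e + 2 ≤ 2 * s` (as in `WallCutCritical.noLossyStrictTailsDeep_of_subcritical`),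
the last binder replaced by: SOME stage `t ≥ N` is a total loss (after the move the newest wall is the only wall).
OPEN. [new] -/
def LossIsFatalDeep : Prop :=
  ∀ p : ℕ, p.Prime → ∀ e : ℕ, 2 ≤ e → ∀ (K : Type) [Field K] [CharP K p] [PerfectField K] [DecidableEq K]
    (s₀ : State (Fin 3) K), IsRoot (p ^ e) s₀ → ∀ W : ForcedWalk (p ^ e) s₀, (∀ i, 1 ≤ (W.st i).shade) →
    ∀ N : ℕ, (∀ t, N ≤ t → (W.st (t + 1)).shade = (W.st t).shade) →
    (∀ t, N ≤ t → ordZero (W.st t).F ≠ ((p ^ e : ℕ) : ℕ∞)) → (∀ M : ℕ, ∃ t, M ≤ t ∧ StaysOnNewest W t) →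
    (∀ M : ℕ, ∃ t, M ≤ t ∧ W.b t ≠ 0) →
    ∀ s : ℕ, (W.st N).shade = (s : ℕ∞) → 3 ≤ s → p ^ e + 3 ≤ 3 * s → p ^ e + 2 ≤ 2 * s → s < p ^ e →
    (∀ (k : Fin 3) (N' : ℕ), ∃ t, N' ≤ t ∧ (W.j t = k ∨ W.b t k ≠ 0)) →
    (∀ t, N ≤ t → ((∀ y, (W.st t).r y + 1 ≤ s) ∧ ∃ x, (W.st t).r x = 0 ∧
      ∃ d ∈ (W.st t).F.support, ((d.degree : ℕ) : ℕ∞) = ordZero (W.st t).F ∧ (W.st t).r x < d x)) →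
    ∀ t : ℕ, N ≤ t → (∀ y, y ≠ W.j t → (W.st (t + 1)).r y = 0) → False

/-- BRANCH `δ = 0` (BOTTOM LOSS): `LossIsFatalDeep` restricted to total losses whose order right after the loss is
the bottom one
`pᵉ + 1`.  Its deepest leaf family (chart switch + full straight untranslated run of length `s − 2`) is closed by the g26 kernel
law `WallCutBottom.bottom_run_false`; the decorated families (first run letter translated, early return to the loss chart,
switch to the third chart translated along the loss letter, immediate deaths) remain.  OPEN. [new] -/
def LossIsFatalBottomDeep : Prop :=
  ∀ p : ℕ, p.Prime → ∀ e : ℕ, 2 ≤ e → ∀ (K : Type) [Field K] [CharP K p] [PerfectField K] [DecidableEq K]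
    (s₀ : State (Fin 3) K), IsRoot (p ^ e) s₀ → ∀ W : ForcedWalk (p ^ e) s₀, (∀ i, 1 ≤ (W.st i).shade) →
    ∀ N : ℕ, (∀ t, N ≤ t → (W.st (t + 1)).shade = (W.st t).shade) →
    (∀ t, N ≤ t → ordZero (W.st t).F ≠ ((p ^ e : ℕ) : ℕ∞)) → (∀ M : ℕ, ∃ t, M ≤ t ∧ StaysOnNewest W t) →
    (∀ M : ℕ, ∃ t, M ≤ t ∧ W.b t ≠ 0) →
    ∀ s : ℕ, (W.st N).shade = (s : ℕ∞) → 3 ≤ s → p ^ e + 3 ≤ 3 * s → p ^ e + 2 ≤ 2 * s → s < p ^ e →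
    (∀ (k : Fin 3) (N' : ℕ), ∃ t, N' ≤ t ∧ (W.j t = k ∨ W.b t k ≠ 0)) →
    (∀ t, N ≤ t → ((∀ y, (W.st t).r y + 1 ≤ s) ∧ ∃ x, (W.st t).r x = 0 ∧
      ∃ d ∈ (W.st t).F.support, ((d.degree : ℕ) : ℕ∞) = ordZero (W.st t).F ∧ (W.st t).r x < d x)) →
    ∀ t : ℕ, N ≤ t → (∀ y, y ≠ W.j t → (W.st (t + 1)).r y = 0) →
    ordZero (W.st (t + 1)).F = ((p ^ e + 1 : ℕ) : ℕ∞) → False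

/-- BRANCH `δ ≥ 1` (DEFECTIVE LOSS): `LossIsFatalDeep` restricted to total losses whose order right after the loss
is NOT `pᵉ + 1`.
By plateau arithmetic (`o = s + |r|`, SMALL) this branch is empty unless `2s ≥ pᵉ + 3` (cells `(8,6)`, `(9,7)`, …).
OPEN. [new] -/
def LossIsFatalDefectDeep : Prop :=
  ∀ p : ℕ, p.Prime → ∀ e : ℕ, 2 ≤ e → ∀ (K : Type) [Field K] [CharP K p] [PerfectField K] [DecidableEq K]
    (s₀ : State (Fin 3) K), IsRoot (p ^ e) s₀ → ∀ W : ForcedWalk (p ^ e) s₀, (∀ i, 1 ≤ (W.st i).shade) →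
    ∀ N : ℕ, (∀ t, N ≤ t → (W.st (t + 1)).shade = (W.st t).shade) →
    (∀ t, N ≤ t → ordZero (W.st t).F ≠ ((p ^ e : ℕ) : ℕ∞)) → (∀ M : ℕ, ∃ t, M ≤ t ∧ StaysOnNewest W t) →
    (∀ M : ℕ, ∃ t, M ≤ t ∧ W.b t ≠ 0) →
    ∀ s : ℕ, (W.st N).shade = (s : ℕ∞) → 3 ≤ s → p ^ e + 3 ≤ 3 * s → p ^ e + 2 ≤ 2 * s → s < p ^ e →
    (∀ (k : Fin 3) (N' : ℕ), ∃ t, N' ≤ t ∧ (W.j t = k ∨ W.b t k ≠ 0)) →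
    (∀ t, N ≤ t → ((∀ y, (W.st t).r y + 1 ≤ s) ∧ ∃ x, (W.st t).r x = 0 ∧
      ∃ d ∈ (W.st t).F.support, ((d.degree : ℕ) : ℕ∞) = ordZero (W.st t).F ∧ (W.st t).r x < d x)) →
    ∀ t : ℕ, N ≤ t → (∀ y, y ≠ W.j t → (W.st (t + 1)).r y = 0) →
    ordZero (W.st (t + 1)).F ≠ ((p ^ e + 1 : ℕ) : ℕ∞) → False

/-- ASSEMBLY OF THE TWO DEFECT BRANCHES (PROVED, pure logic). [new] [folklore] -/
theorem lossIsFatalDeep_of_branches (h0 : LossIsFatalBottomDeep) (h1 : LossIsFatalDefectDeep) : LossIsFatalDeep := by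
  intro p hp e he K _ _ _ _ s₀ hroot W hpos N hplat hne hS hb s hsN h3 h33 h22 hlt hcoord hsd t hNt hloss
  by_cases ho : ordZero (W.st (t + 1)).F = ((p ^ e + 1 : ℕ) : ℕ∞)
  · exact h0 p hp e he K s₀ hroot W hpos N hplat hne hS hb s hsN h3 h33 h22 hlt hcoord hsd t hNt hloss ho
  · exact h1 p hp e he K s₀ hroot W hpos N hplat hne hS hb s hsN h3 h33 h22 hlt hcoord hsd t hNt hloss ho

/-- **THE LOCAL-TO-TAIL STEP (PROVED, hypothesis-free): `LossIsFatalDeep` closes the located residual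
`WallCut.NoLossyStrictTailsDeep`** — the residual's last binder supplies a total loss at some `t ≥ N`, and the critical /
supercritical shades are the landed `WallCutCritical.noLossyStrictTailsDeep_of_subcritical`. [new] [folklore] -/
theorem noLossyStrictTailsDeep_of_lossIsFatalDeep (h : LossIsFatalDeep) : NoLossyStrictTailsDeep := by
  refine noLossyStrictTailsDeep_of_subcritical ?_
  intro p hp e he K _ _ _ _ s₀ hroot W hpos N hplat hne hS hb s hsN h3 h33 h22 hlt hcoord hsd hlossy
  obtain ⟨t, hNt, hloss⟩ := hlossy N
  exact h p hp e he K s₀ hroot W hpos N hplat hne hS hb s hsN h3 h33 h22 hlt hcoord hsd t hNt hloss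

/-- The residual from the two defect branches (PROVED). [new] [folklore] -/
theorem noLossyStrictTailsDeep_of_branches (h0 : LossIsFatalBottomDeep) (h1 : LossIsFatalDefectDeep) :
    NoLossyStrictTailsDeep :=
  noLossyStrictTailsDeep_of_lossIsFatalDeep (lossIsFatalDeep_of_branches h0 h1)

end Summit.ResolutionOfSingularities.ResolutionOfSingularities.Theorems.LossIsFatal
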